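import Summits.ResolutionOfSingularities.ResolutionOfSingularities.Theorems.ConeExit.Negative.ConverseStart

/-!
# `ConeExit` (crux stmt-ResolutionOfSingularities-16883, route `WildCones`): the CONVERSE of the crux
# is false — a refuted natural strengthening (negative-side support, refuter cdisprove seat; this file
# refutes nothing stated in the route)

`ConeExit` says: an isolated multiplicity-`p` state with an ISOLATED multiplicity-`p` successor has
cleaned order exactly `p` and `dL = 1`. The natural strengthening "conversely, order `p` and `dL = 1`
(start isolated of multiplicity `p`, successor of multiplicity `p`) make the — unique, forced —
successor isolated" is FALSE (`coneExit_converse_false`, stated inline over the mirror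
`Negative/Mirror.lean`). Witness `(p, n, κ) = (3, 3, 𝔽₃)`, `conv = u₁²u₂ + u₂⁵ + u₃⁷`
(`Negative/ConverseStart.lean`), chart `u₃`, `τ = 0`: `step_conv` computes the successor
`conv' = u₁²u₂ + u₂⁵u₃² + u₃⁴` through the formal calculus; it has multiplicity `3` (`multP_conv'`) but
is singular along the whole `u₂`-axis — `not_isol_conv'` is a kernel-checked NON-isolatedness proof
(every element of `(∂a')` has vanishing coefficients along the `u₂`-axis, so the classes of `u₂^m` are
linearly independent in `𝔽₃[[u]] ⧸ (∂a')`). Moral for the line: the crux is an EXIT lemma, not a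
persistence lemma — along a run isolatedness must be assumed at every stage (as
`IsolatedForcedTermination` / `NarrowRunsDie` do), never derived.
-/

noncomputable section

-- single-problem summit: the doubled namespace component `ResolutionOfSingularities` is forced by the tree layout
set_option linter.dupNamespace false

namespace Summit.ResolutionOfSingularities.ResolutionOfSingularities.Theorems.ConeExit.Negative

open scoped BigOperators Classical
open MvPowerSeries

/-- The FORCED successor of `conv` (chart `u₃`, translation `0`): `a' = u₁²u₂ + u₂⁵u₃² + u₃⁴`, as a
coefficient function. [folklore] -/
def conv' : (Fin 3 → ℕ) → ZMod 3 :=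
  fun A =>
    if A 0 = 0 ∧ A 1 = 0 ∧ A 2 = 4 then 1
    else if A 0 = 0 ∧ A 1 = 5 ∧ A 2 = 2 then 1
    else if A 0 = 2 ∧ A 1 = 1 ∧ A 2 = 0 then 1
    else 0


/-- Support of `conv'`. [folklore] -/
lemma conv'_ne_zero_iff (A : Fin 3 → ℕ) :
    conv' A ≠ 0 ↔
      (A 0 = 0 ∧ A 1 = 0 ∧ A 2 = 4) ∨
      (A 0 = 0 ∧ A 1 = 5 ∧ A 2 = 2) ∨
      (A 0 = 2 ∧ A 1 = 1 ∧ A 2 = 0) := by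
  constructor
  · intro h
    unfold conv' at h
    split_ifs at h with h1 h2 h3
    · exact Or.inl h1
    · exact Or.inr (Or.inl h2)
    · exact Or.inr (Or.inr (h3))
    · exact absurd rfl h
  · intro h
    unfold conv'
    split_ifs <;> first | decide | (exfalso; omega)


/-- `conv'` is `3`-clean. [folklore] -/
lemma clean_conv' : clean 3 conv' = conv' := by
  funext A
  unfold clean
  split_ifs with h
  · symm
    by_contra hne
    rcases (conv'_ne_zero_iff A).mp hne with hA | hA | hA
    · have := h 2; omega
    · have := h 1; omega
    · have := h 0; omega
  · rfl


/-- `∂_0` of `conv'` over `𝔽_3` (monomial form). [folklore] -/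
lemma pd0_conv' : pd 0 (ser 3 conv') = (monomial (Finsupp.single (0 : Fin 3) 1 + Finsupp.single (1 : Fin 3) 1) (2 : ZMod 3) : MvPowerSeries (Fin 3) (ZMod 3)) := by
  ext A
  rw [coeff_pd_ser, coeff_ser, clean_conv', coeff_monomial]
  have e0 : (A + Finsupp.single (0 : Fin 3) 1 : Fin 3 →₀ ℕ) 0 = A 0 + 1 := by simp
  have e1 : (A + Finsupp.single (0 : Fin 3) 1 : Fin 3 →₀ ℕ) 1 = A 1 := by simp
  have e2 : (A + Finsupp.single (0 : Fin 3) 1 : Fin 3 →₀ ℕ) 2 = A 2 := by simp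
  have hT0 : A = Finsupp.single (0 : Fin 3) 1 + Finsupp.single (1 : Fin 3) 1 ↔ A 0 = 1 ∧ A 1 = 1 ∧ A 2 = 0 := by
    constructor
    · intro h; subst h; simp
    · rintro ⟨h0, h1, h2⟩; ext j; fin_cases j <;> simp [h0, h1, h2]
  unfold conv'
  simp only [e0, e1, e2]
  by_cases hc0 : A 0 = 1 ∧ A 1 = 1 ∧ A 2 = 0
  · rw [if_pos (hT0.mpr hc0),
      if_neg (show ¬ (A 0 + 1 = 0 ∧ A 1 = 0 ∧ A 2 = 4) by omega),
      if_neg (show ¬ (A 0 + 1 = 0 ∧ A 1 = 5 ∧ A 2 = 2) by omega),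
      if_pos (show A 0 + 1 = 2 ∧ A 1 = 1 ∧ A 2 = 0 by omega)]
    rw [show A 0 = 1 by omega]; decide
  · rw [if_neg (show ¬ (A = Finsupp.single (0 : Fin 3) 1 + Finsupp.single (1 : Fin 3) 1) from fun h' => by have := hT0.mp h'; omega),
      if_neg (show ¬ (A 0 + 1 = 0 ∧ A 1 = 0 ∧ A 2 = 4) by omega),
      if_neg (show ¬ (A 0 + 1 = 0 ∧ A 1 = 5 ∧ A 2 = 2) by omega),
      if_neg (show ¬ (A 0 + 1 = 2 ∧ A 1 = 1 ∧ A 2 = 0) by omega),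
      mul_zero]

/-- `∂_1` of `conv'` over `𝔽_3` (monomial form). [folklore] -/
lemma pd1_conv' : pd 1 (ser 3 conv') = (monomial (Finsupp.single (1 : Fin 3) 4 + Finsupp.single (2 : Fin 3) 2) (2 : ZMod 3) + monomial (Finsupp.single (0 : Fin 3) 2) (1 : ZMod 3) : MvPowerSeries (Fin 3) (ZMod 3)) := by
  ext A
  rw [coeff_pd_ser, coeff_ser, clean_conv', map_add, coeff_monomial, coeff_monomial]
  have e0 : (A + Finsupp.single (1 : Fin 3) 1 : Fin 3 →₀ ℕ) 0 = A 0 := by simp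
  have e1 : (A + Finsupp.single (1 : Fin 3) 1 : Fin 3 →₀ ℕ) 1 = A 1 + 1 := by simp
  have e2 : (A + Finsupp.single (1 : Fin 3) 1 : Fin 3 →₀ ℕ) 2 = A 2 := by simp
  have hT0 : A = Finsupp.single (1 : Fin 3) 4 + Finsupp.single (2 : Fin 3) 2 ↔ A 0 = 0 ∧ A 1 = 4 ∧ A 2 = 2 := by
    constructor
    · intro h; subst h; simp
    · rintro ⟨h0, h1, h2⟩; ext j; fin_cases j <;> simp [h0, h1, h2]
  have hT1 : A = Finsupp.single (0 : Fin 3) 2 ↔ A 0 = 2 ∧ A 1 = 0 ∧ A 2 = 0 := by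
    constructor
    · intro h; subst h; simp
    · rintro ⟨h0, h1, h2⟩; ext j; fin_cases j <;> simp [h0, h1, h2]
  unfold conv'
  simp only [e0, e1, e2]
  by_cases hc0 : A 0 = 0 ∧ A 1 = 4 ∧ A 2 = 2
  · rw [if_pos (hT0.mpr hc0),
      if_neg (show ¬ (A = Finsupp.single (0 : Fin 3) 2) from fun h' => by have := hT1.mp h'; omega),
      if_neg (show ¬ (A 0 = 0 ∧ A 1 + 1 = 0 ∧ A 2 = 4) by omega),
      if_pos (show A 0 = 0 ∧ A 1 + 1 = 5 ∧ A 2 = 2 by omega)]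
    rw [show A 1 = 4 by omega]; decide
  · by_cases hc1 : A 0 = 2 ∧ A 1 = 0 ∧ A 2 = 0
    · rw [if_neg (show ¬ (A = Finsupp.single (1 : Fin 3) 4 + Finsupp.single (2 : Fin 3) 2) from fun h' => by have := hT0.mp h'; omega),
        if_pos (hT1.mpr hc1),
        if_neg (show ¬ (A 0 = 0 ∧ A 1 + 1 = 0 ∧ A 2 = 4) by omega),
        if_neg (show ¬ (A 0 = 0 ∧ A 1 + 1 = 5 ∧ A 2 = 2) by omega),
        if_pos (show A 0 = 2 ∧ A 1 + 1 = 1 ∧ A 2 = 0 by omega)]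
      rw [show A 1 = 0 by omega]; decide
    · rw [if_neg (show ¬ (A = Finsupp.single (1 : Fin 3) 4 + Finsupp.single (2 : Fin 3) 2) from fun h' => by have := hT0.mp h'; omega),
        if_neg (show ¬ (A = Finsupp.single (0 : Fin 3) 2) from fun h' => by have := hT1.mp h'; omega),
        if_neg (show ¬ (A 0 = 0 ∧ A 1 + 1 = 0 ∧ A 2 = 4) by omega),
        if_neg (show ¬ (A 0 = 0 ∧ A 1 + 1 = 5 ∧ A 2 = 2) by omega),
        if_neg (show ¬ (A 0 = 2 ∧ A 1 + 1 = 1 ∧ A 2 = 0) by omega),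
        mul_zero,
        add_zero]

/-- `∂_2` of `conv'` over `𝔽_3` (monomial form). [folklore] -/
lemma pd2_conv' : pd 2 (ser 3 conv') = (monomial (Finsupp.single (2 : Fin 3) 3) (1 : ZMod 3) + monomial (Finsupp.single (1 : Fin 3) 5 + Finsupp.single (2 : Fin 3) 1) (2 : ZMod 3) : MvPowerSeries (Fin 3) (ZMod 3)) := by
  ext A
  rw [coeff_pd_ser, coeff_ser, clean_conv', map_add, coeff_monomial, coeff_monomial]
  have e0 : (A + Finsupp.single (2 : Fin 3) 1 : Fin 3 →₀ ℕ) 0 = A 0 := by simp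
  have e1 : (A + Finsupp.single (2 : Fin 3) 1 : Fin 3 →₀ ℕ) 1 = A 1 := by simp
  have e2 : (A + Finsupp.single (2 : Fin 3) 1 : Fin 3 →₀ ℕ) 2 = A 2 + 1 := by simp
  have hT0 : A = Finsupp.single (2 : Fin 3) 3 ↔ A 0 = 0 ∧ A 1 = 0 ∧ A 2 = 3 := by
    constructor
    · intro h; subst h; simp
    · rintro ⟨h0, h1, h2⟩; ext j; fin_cases j <;> simp [h0, h1, h2]
  have hT1 : A = Finsupp.single (1 : Fin 3) 5 + Finsupp.single (2 : Fin 3) 1 ↔ A 0 = 0 ∧ A 1 = 5 ∧ A 2 = 1 := by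
    constructor
    · intro h; subst h; simp
    · rintro ⟨h0, h1, h2⟩; ext j; fin_cases j <;> simp [h0, h1, h2]
  unfold conv'
  simp only [e0, e1, e2]
  by_cases hc0 : A 0 = 0 ∧ A 1 = 0 ∧ A 2 = 3
  · rw [if_pos (hT0.mpr hc0),
      if_neg (show ¬ (A = Finsupp.single (1 : Fin 3) 5 + Finsupp.single (2 : Fin 3) 1) from fun h' => by have := hT1.mp h'; omega),
      if_pos (show A 0 = 0 ∧ A 1 = 0 ∧ A 2 + 1 = 4 by omega)]
    rw [show A 2 = 3 by omega]; decide
  · by_cases hc1 : A 0 = 0 ∧ A 1 = 5 ∧ A 2 = 1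
    · rw [if_neg (show ¬ (A = Finsupp.single (2 : Fin 3) 3) from fun h' => by have := hT0.mp h'; omega),
        if_pos (hT1.mpr hc1),
        if_neg (show ¬ (A 0 = 0 ∧ A 1 = 0 ∧ A 2 + 1 = 4) by omega),
        if_pos (show A 0 = 0 ∧ A 1 = 5 ∧ A 2 + 1 = 2 by omega)]
      rw [show A 2 = 1 by omega]; decide
    · rw [if_neg (show ¬ (A = Finsupp.single (2 : Fin 3) 3) from fun h' => by have := hT0.mp h'; omega),
        if_neg (show ¬ (A = Finsupp.single (1 : Fin 3) 5 + Finsupp.single (2 : Fin 3) 1) from fun h' => by have := hT1.mp h'; omega),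
        if_neg (show ¬ (A 0 = 0 ∧ A 1 = 0 ∧ A 2 + 1 = 4) by omega),
        if_neg (show ¬ (A 0 = 0 ∧ A 1 = 5 ∧ A 2 + 1 = 2) by omega),
        if_neg (show ¬ (A 0 = 2 ∧ A 1 = 1 ∧ A 2 + 1 = 0) by omega),
        mul_zero,
        add_zero]

/-- `conv'` has multiplicity `3`. [folklore] -/
lemma multP_conv' : (∃ A, clean 3 conv' A ≠ 0) ∧
    ∀ A, clean 3 conv' A ≠ 0 → 3 ≤ Finset.sum Finset.univ (fun j => A j) := by
  rw [clean_conv']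
  refine ⟨⟨![2, 1, 0], (conv'_ne_zero_iff _).mpr (by right; right; simp)⟩, ?_⟩
  intro A hA
  rw [Fin.sum_univ_three]
  rcases (conv'_ne_zero_iff A).mp hA with h | h | h <;> omega

/-- **One step of the dynamics** (chart `u₃`, translation `0`) maps `conv` to `conv'`:
`u₁²u₂ + u₂⁵ + u₃⁷ ↦ (u₃³u₁²u₂ + u₃⁵u₂⁵ + u₃⁷)/u₃³ = u₁²u₂ + u₂⁵u₃² + u₃⁴`, already clean. [folklore] -/
lemma step_conv : step 3 (2 : Fin 3) (0 : Fin 3 → ZMod 3) conv = conv' := by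
  unfold step
  rw [clean_conv, if_pos three_le_ord_conv, tr_zero]
  funext B
  have hsum : ∀ B : Fin 3 → ℕ,
      Finset.sum (Finset.univ.erase (2 : Fin 3)) (fun j => B j) = B 0 + B 1 := by
    intro B
    have h := Finset.add_sum_erase Finset.univ (fun j => B j) (Finset.mem_univ (2 : Fin 3))
    rw [Fin.sum_univ_three] at h
    omega
  have h02 : (0 : Fin 3) ≠ 2 := by decide
  have h12 : (1 : Fin 3) ≠ 2 := by decide
  have hall : (∀ j : Fin 3, 3 ∣ B j) ↔ 3 ∣ B 0 ∧ 3 ∣ B 1 ∧ 3 ∣ B 2 :=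
    ⟨fun h => ⟨h 0, h 1, h 2⟩, fun h j => by fin_cases j; exacts [h.1, h.2.1, h.2.2]⟩
  unfold clean dv bl conv conv'
  simp only [hsum, Function.update_self, Function.update_of_ne h02, Function.update_of_ne h12, hall]
  split_ifs <;> first | rfl | omega

/-- Every element of the successor's Jacobian ideal has VANISHING coefficients along the `u₂`-axis
(all three generators lie in `(u₁, u₃)`): the predicate is an ideal-like invariant. [folklore] -/
lemma coeff_axis_eq_zero_of_mem_jac_conv' {x : MvPowerSeries (Fin 3) (ZMod 3)} (hx : x ∈ jac 3 conv')
    (m : ℕ) : coeff (Finsupp.single (1 : Fin 3) m) x = 0 := by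
  revert m
  refine Submodule.span_induction (p := fun x _ => ∀ m, coeff (Finsupp.single (1 : Fin 3) m) x = 0)
    ?_ ?_ ?_ ?_ hx
  · -- generators
    rintro _ ⟨k, rfl⟩ m
    have hne : ∀ (T : Fin 3 →₀ ℕ), (T 0 ≠ 0 ∨ T 2 ≠ 0) → Finsupp.single (1 : Fin 3) m ≠ T := by
      rintro T hT rfl
      simp at hT
    fin_cases k
    · show coeff (Finsupp.single (1 : Fin 3) m) (pd 0 (ser 3 conv')) = 0
      rw [pd0_conv', coeff_monomial, if_neg (hne _ (by simp))]
    · show coeff (Finsupp.single (1 : Fin 3) m) (pd 1 (ser 3 conv')) = 0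
      rw [pd1_conv', map_add, coeff_monomial, coeff_monomial, if_neg (hne _ (by simp)),
        if_neg (hne _ (by simp)), add_zero]
    · show coeff (Finsupp.single (1 : Fin 3) m) (pd 2 (ser 3 conv')) = 0
      rw [pd2_conv', map_add, coeff_monomial, coeff_monomial, if_neg (hne _ (by simp)),
        if_neg (hne _ (by simp)), add_zero]
  · intro m; exact map_zero _
  · intro x y _ _ hx hy m
    rw [map_add, hx m, hy m, add_zero]
  · intro r x _ hx m
    rw [smul_eq_mul, coeff_mul]
    apply Finset.sum_eq_zero
    rintro ⟨q₁, q₂⟩ hq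
    rw [Finset.HasAntidiagonal.mem_antidiagonal] at hq
    -- q₂ ≤ single 1 m forces q₂ = single 1 (q₂ 1)
    have hq2 : q₂ = Finsupp.single (1 : Fin 3) (q₂ 1) := by
      ext j
      by_cases hj : j = 1
      · subst hj; simp
      · have := congrArg (fun f : Fin 3 →₀ ℕ => f j) hq
        simp only [Finsupp.coe_add, Pi.add_apply, Finsupp.single_apply, if_neg (Ne.symm hj)] at this
        rw [Finsupp.single_apply, if_neg (Ne.symm hj)]
        omega
    show coeff q₁ r * coeff q₂ x = 0
    rw [hq2, hx, mul_zero]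

/-- **`conv'` is NOT isolated** (its singular locus contains the `u₂`-axis): the classes of
`1, u₂, u₂², …` are linearly independent in `𝔽₃[[u]] ⧸ (∂a')`. [folklore] -/
lemma not_isol_conv' : ¬ Module.Finite (ZMod 3) (MvPowerSeries (Fin 3) (ZMod 3) ⧸ jac 3 conv') := by
  intro hfin
  haveI := hfin
  haveI : IsNoetherian (ZMod 3) (MvPowerSeries (Fin 3) (ZMod 3) ⧸ jac 3 conv') :=
    IsNoetherian.iff_fg.mpr inferInstance
  have hli : LinearIndependent (ZMod 3)
      (fun m : ℕ => Ideal.Quotient.mk (jac 3 conv') ((X 1 : MvPowerSeries (Fin 3) (ZMod 3)) ^ m)) := by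
    rw [linearIndependent_iff']
    intro s g hsum m hm
    have hmem : (∑ i ∈ s, g i • (X 1 : MvPowerSeries (Fin 3) (ZMod 3)) ^ i) ∈ jac 3 conv' := by
      rw [← Ideal.Quotient.eq_zero_iff_mem, ← Ideal.Quotient.mkₐ_eq_mk (ZMod 3), map_sum]
      simpa only [map_smul, Ideal.Quotient.mkₐ_eq_mk] using hsum
    have hc := coeff_axis_eq_zero_of_mem_jac_conv' hmem m
    rw [map_sum] at hc
    simp only [map_smul, coeff_X_pow, smul_eq_mul, mul_ite, mul_one, mul_zero] at hc
    rw [Finset.sum_eq_single m] at hc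
    · simpa using hc
    · intro b _ hb
      rw [if_neg]
      intro h
      exact hb ((Finsupp.single_injective (1 : Fin 3)) h).symm
    · intro h; exact absurd hm h
  haveI : Finite ℕ := hli.finite_of_isNoetherian
  exact not_finite ℕ


/-- **The CONVERSE of `ConeExit` is false**: cleaned order exactly `p` and `dL = 1` (with the
start isolated of multiplicity `p`) do NOT force the — unique, forced — multiplicity-`p` successor
to be isolated. Witness `(p, n, κ) = (3, 3, 𝔽₃)`, `a = u₁²u₂ + u₂⁵ + u₃⁷` (isolated, multiplicity
`3`, order `3`, `dL = 1`), chart `u₃`, `τ = 0`: the successor `u₁²u₂ + u₂⁵u₃² + u₃⁴` has multiplicity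
`3` but is singular along the whole `u₂`-axis (`Sing(X') ∩ E = P(Crit a₃) ∩ V(a₄) ⊇ P(u₁ = 0)`
since `a₄ = 0`). So the crux is an EXIT lemma, not a persistence lemma: along a run, isolatedness
must be assumed at every stage (as `IsolatedForcedTermination` / `NarrowRunsDie` do), never derived.
[folklore] -/
theorem coneExit_converse_false :
    ¬ ∀ p : ℕ, p.Prime → p ≠ 2 → ∀ n : ℕ, 3 ≤ n → ∀ (κ : Type) [Field κ] [CharP κ p] [PerfectField κ]
        (c : (Fin n → ℕ) → κ) (i : Fin n) (τ : Fin n → κ),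
        Module.Finite κ (MvPowerSeries (Fin n) κ ⧸ jac p c) →
        ((∃ A, clean p c A ≠ 0) ∧ ∀ A, clean p c A ≠ 0 → p ≤ Finset.sum Finset.univ (fun j => A j)) →
        ((∃ A, clean p c A ≠ 0 ∧ Finset.sum Finset.univ (fun j => A j) = p) ∧ dL p c = 1) →
        ((∃ A, clean p (step p i τ c) A ≠ 0) ∧
          ∀ A, clean p (step p i τ c) A ≠ 0 → p ≤ Finset.sum Finset.univ (fun j => A j)) →
        Module.Finite κ (MvPowerSeries (Fin n) κ ⧸ jac p (step p i τ c)) := by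
  intro h
  have key := h 3 Nat.prime_three (by norm_num) 3 le_rfl (ZMod 3) conv 2 0 isol_conv multP_conv
    ⟨ordP_conv, dL_conv⟩ (by rw [step_conv]; exact multP_conv')
  rw [step_conv] at key
  exact not_isol_conv' key

end Summit.ResolutionOfSingularities.ResolutionOfSingularities.Theorems.ConeExit.Negative

end
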